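import Literature.LinearAlgebra.Matrix.ReducedEchelonBasis
import HarnessLib

/-!
# Andrews–Forbes 2022 §2.3 (Def. 2.11, Lemma 2.12) and §8 (Lemma 8.2): weak lossless rank
# condensers (val-lit t24; source `paper:arxiv-2112.00792`; bib `AndrewsForbes2022`)

Typed literature (D-0014/D-0064 statement file; everything here is PROVED, Mathlib + the tree's
`Literature/LinearAlgebra/Matrix/ReducedEchelonBasis.lean` only) for

* R. Andrews, M. A. Forbes, *Ideals, determinants, and straightening: proving and using lower
  bounds for polynomial ideals*, STOC 2022 = arXiv:2112.00792 [`AndrewsForbes2022`], §2.3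
  **Definition 2.11** (weak `(r, L)`-lossless rank condenser, p0013:L86–L92) and
  **Lemma 2.12** ([FS12, FG15]: the matrices `W_ω(α)`, `(W_ω(x))_{i,j} = (ω^i x)^j`, form a weak
  `(r, r(n-r))`-lossless rank condenser, p0014:L5–L17), and §8 **Lemma 8.2** (p0039:L57–L100:
  "`rank(M) < r` iff `det_r(E M Eᵀ) = 0` for all `E ∈ 𝓔`", `|𝓔| ≥ 2L + 1`).

These are the rank-condenser preliminaries of the IPS lower bounds of §8 (Thm. 8.3, Cor. 8.4,
Thm. 8.6; companion file), the last numbered statements of the source not yet in the tree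
(`AndrewsForbes2022Applications.lean`, "NOT typed here … to be typed on request").
Locators `pNNNN.txt:Lnn` refer to the chunk files of `lit read paper:arxiv-2112.00792`.

## Main statements

* `IsWeakLosslessRankCondenser F r L 𝓔` — **Def. 2.11**: for every `A ∈ F^{n × r}` of rank `r`,
  at most `L` matrices `E ∈ 𝓔 ⊆ F^{t × n}` have `rank(E A) < rank(A)`.
* `fsCondenser F r n ω α = W_ω(α)` and **`AndrewsForbes2022_lemma_2_12`** (PROVED): for
  `ω ∈ F^×` of multiplicative order `≥ n` and a finite `S ⊆ F ∖ {0}`, `{W_ω(α) : α ∈ S}` is a weak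
  `(r, r(n-r))`-lossless rank condenser.  Proof as in [FS12]/[Forbes 2014, §5]:
  `det(W_ω(x) A) ∈ F[x]`; after a change of basis of the column space of `A` to a basis with
  distinct orders (resp. distinct degrees) — the tree's reduced echelon bases
  (`Literature.LinearAlgebra.Matrix.Echelon.exists_echelon_basis`) — its lowest coefficient is a
  (nonzero) Vandermonde determinant in the distinct powers `ω^{t_k}` and its degree exceeds its
  order by at most `r(n-r)`, so it has at most `r(n-r)` nonzero roots.
* **`AndrewsForbes2022_lemma_8_2`** — Lemma 8.2 AS PRINTED, a named statement which is
  **FALSE**: `not_AndrewsForbes2022_lemma_8_2` (ERRATUM, found while typing: for `r = 1`, `n = 2`,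
  the alternating matrix `M = (0 1; -1 0)` has rank `2`, yet `E M Eᵀ = 0` for EVERY row vector `E`;
  the printed proof's step "`rank(EA) = r` and `rank(EB) = r` implies `rank(E A Bᵀ Eᵀ) = r`"
  (p0039:L94–L97) fails when `rank(M) > r`; the same happens for every odd `r < rank M` with `M`
  alternating).  The direction "`rank(M) < r ⇒ det_r(E M Eᵀ) = 0`" holds
  (`AndrewsForbes2022_lemma_8_2_mp`), and the natural repair with the condenser applied
  INDEPENDENTLY on the two sides is PROVED: **`AndrewsForbes2022_lemma_8_2_twoSided`** —
  for a weak `(r, L)`-lossless `𝓔` with `|𝓔| ≥ L + 1`, `rank(M) < r` iff `det_r(E M E'ᵀ) = 0` for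
  all `E, E' ∈ 𝓔`.  (Theorems 8.3/8.4/8.6 quantify over IPS refutations of the printed system and
  are unaffected — they hold as printed, vacuously where the printed system is satisfiable; see
  the companion file.)

Honest framing: typed (and here fully proved) literature for the val-lit NP corpus; VP ≠ VNP is
NOT proved and nothing here is progress on it.

## References

* [AndrewsForbes2022] R. Andrews, M. A. Forbes, STOC 2022, doi:10.1145/3519935.3520025,
  arXiv:2112.00792 — §2.3 Def. 2.11, Lemma 2.12; §8 Lemma 8.2.
* [ForbesShpilka2012] M. A. Forbes, A. Shpilka, *On identity testing of tensors, low-rank recovery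
  and compressed sensing*, STOC 2012 (the construction `W_ω`); M. A. Forbes, V. Guruswami,
  RANDOM 2015 (the analysis `L = r(n-r)`), both cited through [AndrewsForbes2022, Lemma 2.12].
-/

noncomputable section

open Matrix Polynomial Finset

namespace Literature.Computability.AlgebraicComplexity

universe u

/-! ### §2.3 Definition 2.11: weak lossless rank condensers; the matrices `W_ω(α)` of Lemma 2.12 -/

section Defs

variable (F : Type u) [Field F]

open scoped Classical in
/-- **Andrews–Forbes 2022, Definition 2.11** (p0013:L86–L92): "Let `F` be a field and let
`n ≥ r ≥ 1`. A collection of matrices `𝓔 ⊆ F^{t × n}` is a weak `(r, L)`-lossless rank condenser if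
for all matrices `A ∈ F^{n × r}` with `rank(A) = r`, we have
`|{E : E ∈ 𝓔, rank(EA) < rank(A)}| ≤ L`."  The collection is a `Finset` (its size is what the
definition and Lemma 8.2 count); `rank(A) = r` is substituted in `rank(EA) < rank(A)`.  (The ambient
`n ≥ r ≥ 1` is not needed to state it: for `r > n` there is no `A`, for `r = 0` no `E` counts.)
[cite: AndrewsForbes2022, Def. 2.11] -/
def IsWeakLosslessRankCondenser {t n : ℕ} (r L : ℕ) (𝓔 : Finset (Matrix (Fin t) (Fin n) F)) :
    Prop :=
  ∀ A : Matrix (Fin n) (Fin r) F, A.rank = r → (𝓔.filter fun E => (E * A).rank < r).card ≤ L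

/-- **The matrix `W_ω(α) ∈ F^{r × n}` of Lemma 2.12** ([FS12]; p0014:L9): `(W_ω(x))_{i,j} = (ω^i x)^j`
for `i ∈ [r]`, `j ∈ [n]` (printed `1`-indexed: row `i : Fin r` carries `ω^{i+1}`, column `j : Fin n`
the exponent `j + 1`), evaluated at `x = α`. [cite: AndrewsForbes2022, Lemma 2.12] -/
def fsCondenser (r n : ℕ) (ω α : F) : Matrix (Fin r) (Fin n) F :=
  Matrix.of fun i j => (ω ^ ((i : ℕ) + 1) * α) ^ ((j : ℕ) + 1)

/-- `W_ω(x) ∈ F[x]^{r × n}`, the same matrix with `x` an indeterminate. [cite: AndrewsForbes2022, Lemma 2.12] -/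
def fsCondenserPoly (r n : ℕ) (ω : F) : Matrix (Fin r) (Fin n) F[X] :=
  Matrix.of fun i j => (C (ω ^ ((i : ℕ) + 1)) * X) ^ ((j : ℕ) + 1)

variable {F}

/-- Entries of `W_ω(α)`. [cite: AndrewsForbes2022, Lemma 2.12] -/
@[simp] theorem fsCondenser_apply (r n : ℕ) (ω α : F) (i : Fin r) (j : Fin n) :
    fsCondenser F r n ω α i j = (ω ^ ((i : ℕ) + 1) * α) ^ ((j : ℕ) + 1) := rfl

/-- Entries of `W_ω(x)`. [cite: AndrewsForbes2022, Lemma 2.12] -/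
@[simp] theorem fsCondenserPoly_apply (r n : ℕ) (ω : F) (i : Fin r) (j : Fin n) :
    fsCondenserPoly F r n ω i j = (C (ω ^ ((i : ℕ) + 1)) * X) ^ ((j : ℕ) + 1) := rfl

/-- `W_ω(α)` is `W_ω(x)` evaluated at `x = α`. [cite: AndrewsForbes2022, Lemma 2.12] -/
theorem fsCondenserPoly_map_eval (r n : ℕ) (ω α : F) :
    (fsCondenserPoly F r n ω).map (Polynomial.eval α) = fsCondenser F r n ω α := by
  ext i j
  simp [eval_pow, eval_mul]

/-- A monotone (in `L`) and antitone (in `𝓔`) notion. [cite: AndrewsForbes2022, Def. 2.11] -/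
theorem IsWeakLosslessRankCondenser.mono {t n r L L' : ℕ} {𝓔 𝓔' : Finset (Matrix (Fin t) (Fin n) F)}
    (h : IsWeakLosslessRankCondenser F r L 𝓔) (hL : L ≤ L') (h𝓔 : 𝓔' ⊆ 𝓔) :
    IsWeakLosslessRankCondenser F r L' 𝓔' := by
  classical
  intro A hA
  exact ((Finset.card_le_card (Finset.filter_subset_filter _ h𝓔)).trans (h A hA)).trans hL

end Defs

/-! ### Rank versus determinant for square matrices over a field (bookkeeping) -/

section RankDet

variable {F : Type u} [Field F] {m : Type*} [Fintype m] [DecidableEq m]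

/-- A square matrix with nonzero determinant has full rank. [folklore] -/
private theorem rank_eq_card_of_det_ne_zero {A : Matrix m m F} (h : A.det ≠ 0) :
    A.rank = Fintype.card m :=
  rank_of_isUnit A ((Matrix.isUnit_iff_isUnit_det A).mpr (Ne.isUnit h))

/-- A square matrix of full rank has nonzero determinant. [folklore] -/
private theorem det_ne_zero_of_rank_eq_card {A : Matrix m m F} (h : A.rank = Fintype.card m) :
    A.det ≠ 0 := by
  have htop : LinearMap.range A.mulVecLin = ⊤ := by
    apply Submodule.eq_top_of_finrank_eq
    rw [Module.finrank_fintype_fun_eq_card]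
    exact h
  have hunit : IsUnit A.mulVecLin := (LinearMap.isUnit_iff_range_eq_top _).mpr htop
  rw [← Matrix.toLin'_apply', Matrix.isUnit_toLin'_iff, Matrix.isUnit_iff_isUnit_det] at hunit
  exact hunit.ne_zero

/-- A square matrix of deficient rank has determinant zero. [folklore] -/
private theorem det_eq_zero_of_rank_lt_card {A : Matrix m m F} (h : A.rank < Fintype.card m) :
    A.det = 0 := by
  by_contra hne
  exact absurd (rank_eq_card_of_det_ne_zero hne) h.ne

omit [DecidableEq m] in
/-- If `rank M ≥ r` then some `n × r` matrix of the form `M G` has rank `r` (its columns are `r`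
linearly independent vectors of the column space of `M`). [folklore] -/
private theorem exists_rank_mul_eq {n : Type*} [Fintype n] {r : ℕ}
    (M : Matrix m n F) (h : r ≤ M.rank) :
    ∃ G : Matrix n (Fin r) F, (M * G).rank = r := by
  classical
  set W : Submodule F (m → F) := LinearMap.range M.mulVecLin with hW
  have hfin : r ≤ Module.finrank F W := h
  obtain ⟨f, hf⟩ := exists_linearIndependent_of_le_finrank hfin
  have hmem : ∀ k, ∃ g : n → F, M *ᵥ g = (f k : m → F) := fun k => by
    obtain ⟨g, hg⟩ := LinearMap.mem_range.mp (f k).2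
    exact ⟨g, by simpa [Matrix.mulVecLin_apply] using hg⟩
  choose g hg using hmem
  refine ⟨Matrix.of fun j k => g k j, ?_⟩
  have hrows : (M * Matrix.of fun j k => g k j)ᵀ.row = fun k => ((f k : W) : m → F) := by
    funext k i
    have := congr_fun (hg k) i
    simp only [Matrix.mulVec, dotProduct] at this
    simpa [Matrix.row, Matrix.transpose_apply, Matrix.mul_apply] using this
  have hli : LinearIndependent F (fun k => ((f k : W) : m → F)) :=
    hf.map' W.subtype (Submodule.ker_subtype W)
  have ht : (M * Matrix.of fun j k => g k j)ᵀ.rank = Fintype.card (Fin r) :=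
    LinearIndependent.rank_matrix (by rw [hrows]; exact hli)
  rw [rank_transpose, Fintype.card_fin] at ht
  exact ht

end RankDet

/-! ### The polynomial `det(W_ω(x) B)` and its order / degree structure -/

section CondPoly

variable {F : Type u} [Field F]

/-- `det(W_ω(x) · B) ∈ F[x]` for `B ∈ F^{n × r}`: the polynomial whose nonzero roots are the bad
`α` for `B`. [cite: AndrewsForbes2022, Lemma 2.12] -/
def condPoly (r n : ℕ) (ω : F) (B : Matrix (Fin n) (Fin r) F) : F[X] :=
  (fsCondenserPoly F r n ω * B.map C).det

/-- `det(W_ω(x) B)` evaluated at `α` is `det(W_ω(α) B)`. [cite: AndrewsForbes2022, Lemma 2.12] -/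
theorem condPoly_eval (r n : ℕ) (ω : F) (B : Matrix (Fin n) (Fin r) F) (α : F) :
    (condPoly r n ω B).eval α = (fsCondenser F r n ω α * B).det := by
  unfold condPoly
  rw [← Polynomial.coe_evalRingHom, RingHom.map_det, RingHom.mapMatrix_apply, Matrix.map_mul,
    Matrix.map_map, Polynomial.coe_evalRingHom, fsCondenserPoly_map_eval]
  have hB : B.map (Polynomial.eval α ∘ (C : F → F[X])) = B := Matrix.ext fun i j => by simp
  rw [hB]

/-- Change of basis of the columns multiplies `det(W_ω(x) B)` by a constant:
`det(W_ω(x) (B G)) = det(W_ω(x) B) · det G`. [cite: AndrewsForbes2022, Lemma 2.12] -/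
theorem condPoly_mul (r n : ℕ) (ω : F) (B : Matrix (Fin n) (Fin r) F) (G : Matrix (Fin r) (Fin r) F) :
    condPoly r n ω (B * G) = condPoly r n ω B * C G.det := by
  unfold condPoly
  rw [Matrix.map_mul, ← Matrix.mul_assoc, det_mul, RingHom.map_det, RingHom.mapMatrix_apply]

/-- Entries of `W_ω(x) B`: `(W_ω(x) B)_{i,k} = Σ_j ω^{(i+1)(j+1)} B_{j,k} x^{j+1}`.
[cite: AndrewsForbes2022, Lemma 2.12] -/
theorem condMat_apply (r n : ℕ) (ω : F) (B : Matrix (Fin n) (Fin r) F) (i : Fin r) (k : Fin r) :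
    (fsCondenserPoly F r n ω * B.map C) i k =
      ∑ j : Fin n, C (ω ^ (((i : ℕ) + 1) * ((j : ℕ) + 1)) * B j k) * X ^ ((j : ℕ) + 1) := by
  simp only [Matrix.mul_apply, Matrix.map_apply, fsCondenserPoly_apply]
  refine Finset.sum_congr rfl fun j _ => ?_
  rw [mul_pow, ← C_pow, ← pow_mul, C_mul]
  ring

/-- Pulling a power of `x` out of every column: `det(x^{e_k} N_{i,k}) = x^{Σ e_k} det N`. [folklore] -/
private theorem det_X_pow_mul {r : ℕ} (e : Fin r → ℕ) (N : Matrix (Fin r) (Fin r) F[X]) :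
    (Matrix.of fun i k => X ^ e k * N i k).det = X ^ (∑ k, e k) * N.det := by
  rw [det_mul_row, Finset.prod_pow_eq_pow_sum]

/-- Degree of a determinant from column-wise degree bounds: if every entry of column `k` has
`natDegree ≤ d_k` then `natDegree (det M) ≤ Σ_k d_k` (Leibniz expansion). [folklore] -/
private theorem natDegree_det_le_sum {r : ℕ} (M : Matrix (Fin r) (Fin r) F[X]) (d : Fin r → ℕ)
    (hM : ∀ i k, (M i k).natDegree ≤ d k) : M.det.natDegree ≤ ∑ k, d k := by
  rw [det_apply]
  refine natDegree_sum_le_of_forall_le _ _ fun σ _ => ?_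
  calc (Equiv.Perm.sign σ • ∏ i, M (σ i) i).natDegree ≤ (∏ i, M (σ i) i).natDegree := by
        rcases Int.units_eq_one_or (Equiv.Perm.sign σ) with h | h
        · rw [h, one_smul]
        · rw [h, Units.neg_smul, one_smul, natDegree_neg]
    _ ≤ ∑ i, (M (σ i) i).natDegree := natDegree_prod_le _ _
    _ ≤ ∑ i, d i := Finset.sum_le_sum fun i _ => hM _ _

/-- **Order structure.** If column `k` of `B` vanishes above row `t_k` (`B_{j,k} = 0` for
`j < t_k`), then `det(W_ω(x) B) = x^{Σ_k (t_k + 1)} · Q(x)` with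
`Q(0) = det(ω^{(i+1)(t_k+1)} B_{t_k,k})_{i,k}`. [cite: AndrewsForbes2022, Lemma 2.12] -/
theorem condPoly_eq_X_pow_mul {r n : ℕ} (ω : F) (B : Matrix (Fin n) (Fin r) F) (t : Fin r → Fin n)
    (hlow : ∀ j k, j < t k → B j k = 0) :
    ∃ Q : F[X], condPoly r n ω B = X ^ (∑ k, ((t k : ℕ) + 1)) * Q ∧
      Q.coeff 0 = (Matrix.of fun i k : Fin r =>
        ω ^ (((i : ℕ) + 1) * ((t k : ℕ) + 1)) * B (t k) k).det := by
  classical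
  -- the cofactor matrix `N` with `(W B)_{i,k} = x^{t_k + 1} N_{i,k}`
  let N : Matrix (Fin r) (Fin r) F[X] := Matrix.of fun i k =>
    ∑ j : Fin n, if t k ≤ j then
      C (ω ^ (((i : ℕ) + 1) * ((j : ℕ) + 1)) * B j k) * X ^ ((j : ℕ) - (t k : ℕ)) else 0
  have hWB : fsCondenserPoly F r n ω * B.map C = Matrix.of fun i k => X ^ ((t k : ℕ) + 1) * N i k := by
    refine Matrix.ext fun i k => ?_
    rw [condMat_apply]
    simp only [N, Matrix.of_apply, Finset.mul_sum]
    refine Finset.sum_congr rfl fun j _ => ?_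
    by_cases hj : t k ≤ j
    · rw [if_pos hj, mul_left_comm, ← pow_add]
      congr 2
      have : (t k : ℕ) ≤ (j : ℕ) := hj
      omega
    · rw [if_neg hj, mul_zero, hlow j k (lt_of_not_ge hj), mul_zero, C_0, zero_mul]
  refine ⟨N.det, by rw [condPoly, hWB, det_X_pow_mul], ?_⟩
  -- constant coefficient of `det N` = `det` of the constant coefficients
  rw [coeff_zero_eq_eval_zero, ← Polynomial.coe_evalRingHom, RingHom.map_det,
    RingHom.mapMatrix_apply]
  congr 1
  refine Matrix.ext fun i k => ?_
  simp only [Matrix.map_apply, Matrix.of_apply, N, Polynomial.coe_evalRingHom, eval_finsetSum]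
  rw [Finset.sum_eq_single (t k)]
  · simp
  · intro j _ hj
    by_cases hjk : t k ≤ j
    · have hne : (j : ℕ) - (t k : ℕ) ≠ 0 := by
        have h1 : (t k : ℕ) ≤ j := hjk
        have h2 : (t k : ℕ) ≠ j := fun h => hj (Fin.ext h).symm
        omega
      rw [if_pos hjk, eval_mul, eval_C, eval_pow, eval_X, zero_pow hne, mul_zero]
    · rw [if_neg hjk, eval_zero]
  · intro h
    exact absurd (Finset.mem_univ _) h

/-- **Degree structure.** If column `k` of `B` vanishes below row `t_k` (`B_{j,k} = 0` for
`j > t_k`), then `natDegree det(W_ω(x) B) ≤ Σ_k (t_k + 1)`. [cite: AndrewsForbes2022, Lemma 2.12] -/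
theorem natDegree_condPoly_le {r n : ℕ} (ω : F) (B : Matrix (Fin n) (Fin r) F) (t : Fin r → Fin n)
    (hupp : ∀ j k, t k < j → B j k = 0) :
    (condPoly r n ω B).natDegree ≤ ∑ k, ((t k : ℕ) + 1) := by
  refine natDegree_det_le_sum _ _ fun i k => ?_
  rw [condMat_apply]
  refine natDegree_sum_le_of_forall_le _ _ fun j _ => ?_
  by_cases hj : t k < j
  · rw [hupp j k hj, mul_zero, C_0, zero_mul, natDegree_zero]
    exact Nat.zero_le _
  · refine natDegree_C_mul_X_pow_le _ _ |>.trans ?_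
    have : (j : ℕ) ≤ (t k : ℕ) := not_lt.mp hj
    omega

/-- The generalized Vandermonde determinant `det(v_k^{i+1})_{i,k ∈ [r]} = (∏ v_k) · det V(v)` is
nonzero for pairwise distinct nonzero `v_k`. [folklore] -/
private theorem det_pow_succ_ne_zero {r : ℕ} (v : Fin r → F) (hv : Function.Injective v)
    (h0 : ∀ k, v k ≠ 0) : (Matrix.of fun i k : Fin r => v k ^ ((i : ℕ) + 1)).det ≠ 0 := by
  have hmat : (Matrix.of fun i k : Fin r => v k ^ ((i : ℕ) + 1)) =
      Matrix.of fun i k => v k * (vandermonde v)ᵀ i k := by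
    ext i k
    simp [vandermonde, pow_succ']
  rw [hmat, det_mul_row, det_transpose]
  exact mul_ne_zero (Finset.prod_ne_zero_iff.mpr fun k _ => h0 k) (det_vandermonde_ne_zero_iff.mpr hv)

/-- Distinct small powers of an element of multiplicative order `≥ n` are distinct: if
`ω^k ≠ 1` for `0 < k < n` then `a ↦ ω^{a+1}` is injective on `[0, n)`. [folklore] -/
private theorem pow_succ_injective_of_order {n : ℕ} {ω : F} (hω0 : ω ≠ 0)
    (hω : ∀ k : ℕ, 0 < k → k < n → ω ^ k ≠ 1) {a b : Fin n}
    (h : ω ^ ((a : ℕ) + 1) = ω ^ ((b : ℕ) + 1)) : a = b := by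
  -- reduce to `a ≤ b`
  wlog hab : (a : ℕ) ≤ (b : ℕ) generalizing a b
  · exact (this h.symm (le_of_not_ge hab)).symm
  have hsplit : ω ^ ((b : ℕ) + 1) = ω ^ ((a : ℕ) + 1) * ω ^ ((b : ℕ) - (a : ℕ)) := by
    rw [← pow_add]; congr 1; omega
  rw [hsplit] at h
  have hone : ω ^ ((b : ℕ) - (a : ℕ)) = 1 := by
    have h' : ω ^ ((a : ℕ) + 1) * ω ^ ((b : ℕ) - (a : ℕ)) = ω ^ ((a : ℕ) + 1) * 1 := by
      rw [mul_one]; exact h.symm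
    exact mul_left_cancel₀ (pow_ne_zero _ hω0) h'
  by_contra hne
  have hlt : (a : ℕ) < (b : ℕ) := lt_of_le_of_ne hab (fun e => hne (Fin.ext e))
  exact hω ((b : ℕ) - (a : ℕ)) (by omega) (by omega) hone

end CondPoly

/-! ### Adapted bases of the column space (from the tree's reduced echelon bases) -/

section Adapted

variable {F : Type u} [Field F]

/-- A linearly independent `r`-family `q` in the column space of `A ∈ F^{n × r}` is `A G` for an
invertible `G` (columns of `A G` = the `q_k`). [folklore] -/
private theorem exists_mul_eq_of_linearIndependent {n r : ℕ} (A : Matrix (Fin n) (Fin r) F)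
    (q : Fin r → (Fin n → F)) (hq : LinearIndependent F q)
    (hmem : ∀ k, q k ∈ Submodule.span F (Set.range A.col)) :
    ∃ G : Matrix (Fin r) (Fin r) F, G.det ≠ 0 ∧ A * G = Matrix.of fun j k => q k j := by
  classical
  have hcoef : ∀ k, ∃ c : Fin r → F, ∑ i, c i • A.col i = q k := fun k =>
    (Submodule.mem_span_range_iff_exists_fun F).mp (hmem k)
  choose g hg using hcoef
  refine ⟨Matrix.of fun i k => g k i, ?_, ?_⟩
  · -- invertibility: a kernel vector of `G` gives a dependence among the `q_k`
    intro hdet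
    obtain ⟨c, hc0, hc⟩ := Matrix.exists_mulVec_eq_zero_iff.mpr hdet
    have hsum : ∑ k, c k • q k = 0 := by
      funext j
      have hq' : ∀ k, q k j = ∑ i, g k i * A j i := fun k => by
        have := congr_fun (hg k) j
        simpa [Finset.sum_apply, Pi.smul_apply, Matrix.col, Matrix.transpose_apply] using this.symm
      have hAG : (A *ᵥ ((Matrix.of fun i k => g k i) *ᵥ c)) j = 0 := by rw [hc, Matrix.mulVec_zero]; rfl
      rw [Matrix.mulVec_mulVec] at hAG
      simp only [Matrix.mulVec, dotProduct, Matrix.mul_apply, Matrix.of_apply] at hAG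
      simp only [Finset.sum_apply, Pi.smul_apply, smul_eq_mul, Pi.zero_apply, hq']
      rw [← hAG]
      refine Finset.sum_congr rfl fun k _ => ?_
      rw [Finset.sum_mul, mul_comm, Finset.sum_mul]
      exact Finset.sum_congr rfl fun i _ => by ring
    exact hc0 (funext fun k => (Fintype.linearIndependent_iff.mp hq c hsum k))
  · ext j k
    have := congr_fun (hg k) j
    simp only [Finset.sum_apply, Pi.smul_apply, smul_eq_mul] at this
    rw [Matrix.mul_apply, Matrix.of_apply, ← this]
    exact Finset.sum_congr rfl fun i _ => by simp [Matrix.col, mul_comm]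

/-- **Degree-adapted basis.** The column space of a rank-`r` matrix `A ∈ F^{n × r}` has a basis
with pairwise distinct "degrees" (last nonzero coordinates) `t_1 < ⋯ < t_r`, normalised: there is
an invertible `G` with `(AG)_{t_k,k} = 1` and `(AG)_{j,k} = 0` for `j > t_k` — the reduced column
echelon form (`Echelon.exists_echelon_basis`). [folklore] -/
private theorem exists_mul_degreeAdapted {n r : ℕ} (A : Matrix (Fin n) (Fin r) F) (hA : A.rank = r) :
    ∃ (G : Matrix (Fin r) (Fin r) F) (t : Fin r → Fin n), G.det ≠ 0 ∧ StrictMono t ∧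
      (∀ k, (A * G) (t k) k = 1) ∧ ∀ j k, t k < j → (A * G) j k = 0 := by
  classical
  set V : Submodule F (Fin n → F) := Submodule.span F (Set.range A.col) with hV
  obtain ⟨S, a, hSa, hspan, hli, hcard⟩ :=
    Literature.LinearAlgebra.Matrix.Echelon.exists_echelon_basis V
  rw [← rank_eq_finrank_span_cols, hA] at hcard
  let e : Fin r ↪o Fin n := S.orderEmbOfFin hcard
  have he : ∀ k, e k ∈ S := fun k => S.orderEmbOfFin_mem hcard k
  let q : Fin r → (Fin n → F) := fun k => Literature.LinearAlgebra.Matrix.Echelon.echelonVec a (e k)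
  have hqmem : ∀ k, q k ∈ V := fun k => by
    rw [← hspan]
    exact Submodule.subset_span ⟨e k, he k, rfl⟩
  have hqli : LinearIndependent F q := by
    have hinj : Function.Injective (fun k : Fin r => (⟨e k, he k⟩ : S)) :=
      fun k k' h => e.injective (congrArg Subtype.val h)
    exact hli.comp _ hinj
  obtain ⟨G, hG, hAG⟩ := exists_mul_eq_of_linearIndependent A q hqli hqmem
  refine ⟨G, e, hG, e.strictMono, fun k => ?_, fun j k hjk => ?_⟩
  · rw [hAG, Matrix.of_apply]
    exact Literature.LinearAlgebra.Matrix.Echelon.echelonVec_apply_self a (e k)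
  · rw [hAG, Matrix.of_apply]
    change Literature.LinearAlgebra.Matrix.Echelon.echelonVec a (e k) j = 0
    rw [Literature.LinearAlgebra.Matrix.Echelon.echelonVec_apply_of_ne a (ne_of_gt hjk)]
    exact hSa.apply_eq_zero_of_le hjk.le

/-- **Order-adapted basis.** Dually (reverse the coordinates), there is an invertible `G` and
`t_1 < ⋯ < t_r` with `(AG)_{t_k,k} = 1` and `(AG)_{j,k} = 0` for `j < t_k` (pairwise distinct
orders = first nonzero coordinates). [folklore] -/
private theorem exists_mul_orderAdapted {n r : ℕ} (A : Matrix (Fin n) (Fin r) F) (hA : A.rank = r) :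
    ∃ (G : Matrix (Fin r) (Fin r) F) (t : Fin r → Fin n), G.det ≠ 0 ∧ StrictMono t ∧
      (∀ k, (A * G) (t k) k = 1) ∧ ∀ j k, j < t k → (A * G) j k = 0 := by
  classical
  set V : Submodule F (Fin n → F) := Submodule.span F (Set.range A.col) with hV
  -- reverse the coordinates
  let ρ : (Fin n → F) ≃ₗ[F] (Fin n → F) := LinearEquiv.funCongrLeft F F (Fin.revPerm : Equiv.Perm (Fin n))
  have hρ : ∀ (x : Fin n → F) (i : Fin n), ρ x i = x (Fin.rev i) := fun x i => rfl
  set V' : Submodule F (Fin n → F) := V.map (ρ : (Fin n → F) →ₗ[F] (Fin n → F)) with hV'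
  obtain ⟨S, a, hSa, hspan, hli, hcard⟩ :=
    Literature.LinearAlgebra.Matrix.Echelon.exists_echelon_basis V'
  rw [hV', LinearEquiv.finrank_map_eq, ← rank_eq_finrank_span_cols, hA] at hcard
  let e : Fin r ↪o Fin n := S.orderEmbOfFin hcard
  have he : ∀ k, e k ∈ S := fun k => S.orderEmbOfFin_mem hcard k
  let w : Fin r → (Fin n → F) := fun k => Literature.LinearAlgebra.Matrix.Echelon.echelonVec a (e k)
  have hwmem : ∀ k, w k ∈ V' := fun k => by
    rw [← hspan]
    exact Submodule.subset_span ⟨e k, he k, rfl⟩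
  -- pull back: `q_k(j) = w_{rev k}(rev j)`
  let q : Fin r → (Fin n → F) := fun k j => w (Fin.rev k) (Fin.rev j)
  have hqmem : ∀ k, q k ∈ V := fun k => by
    obtain ⟨v, hv, hvw⟩ := Submodule.mem_map.mp (hwmem (Fin.rev k))
    have hqv : q k = v := by
      funext j
      change w (Fin.rev k) (Fin.rev j) = v j
      rw [← hvw]
      change ρ v (Fin.rev j) = v j
      rw [hρ, Fin.rev_rev]
    rw [hqv]
    exact hv
  have hqli : LinearIndependent F q := by
    have hinj : Function.Injective (fun k : Fin r => (⟨e (Fin.rev k), he (Fin.rev k)⟩ : S)) :=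
      fun k k' h => Fin.rev_injective (e.injective (congrArg Subtype.val h))
    have hli' : LinearIndependent F (fun k : Fin r => w (Fin.rev k)) := hli.comp _ hinj
    rw [Fintype.linearIndependent_iff] at hli' ⊢
    intro c hc k
    refine hli' c ?_ k
    funext i
    have := congr_fun hc (Fin.rev i)
    simp only [Finset.sum_apply, Pi.smul_apply, smul_eq_mul, Pi.zero_apply, q, Fin.rev_rev] at this ⊢
    exact this
  obtain ⟨G, hG, hAG⟩ := exists_mul_eq_of_linearIndependent A q hqli hqmem
  refine ⟨G, fun k => Fin.rev (e (Fin.rev k)), hG, ?_, fun k => ?_, fun j k hjk => ?_⟩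
  · intro k k' hkk
    exact Fin.rev_lt_rev.mpr (e.strictMono (Fin.rev_lt_rev.mpr hkk))
  · rw [hAG, Matrix.of_apply]
    change w (Fin.rev k) (Fin.rev (Fin.rev (e (Fin.rev k)))) = 1
    rw [Fin.rev_rev]
    exact Literature.LinearAlgebra.Matrix.Echelon.echelonVec_apply_self a _
  · rw [hAG, Matrix.of_apply]
    change Literature.LinearAlgebra.Matrix.Echelon.echelonVec a (e (Fin.rev k)) (Fin.rev j) = 0
    have hlt : e (Fin.rev k) < Fin.rev j := by
      rw [← Fin.rev_lt_rev, Fin.rev_rev]; exact hjk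
    rw [Literature.LinearAlgebra.Matrix.Echelon.echelonVec_apply_of_ne a (ne_of_gt hlt)]
    exact hSa.apply_eq_zero_of_le hlt.le

/-- Values of a strictly increasing `t : Fin r → Fin n` are at least their index. [folklore] -/
private theorem strictMono_val_le_apply {r n : ℕ} {t : Fin r → Fin n} (ht : StrictMono t) (k : Fin r) :
    (k : ℕ) ≤ (t k : ℕ) := by
  obtain ⟨k, hk⟩ := k
  induction k with
  | zero => exact Nat.zero_le _
  | succ k ih =>
    have h1 := ih (Nat.lt_of_succ_lt hk)
    have h2 : t ⟨k, Nat.lt_of_succ_lt hk⟩ < t ⟨k + 1, hk⟩ := ht (Fin.mk_lt_mk.mpr (Nat.lt_succ_self k))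
    rw [Fin.lt_def] at h2
    simp only at h1 ⊢
    omega

/-- … and at most `n - r` more than their index: `t_k + r ≤ n + k`. [folklore] -/
private theorem strictMono_apply_add_le {r n : ℕ} {t : Fin r → Fin n} (ht : StrictMono t) (k : Fin r) :
    (t k : ℕ) + r ≤ n + (k : ℕ) := by
  -- apply `strictMono_val_le_apply` to the reversed map `k ↦ rev (t (rev k))`
  have ht' : StrictMono (fun k : Fin r => Fin.rev (t (Fin.rev k))) := fun a b hab =>
    Fin.rev_lt_rev.mpr (ht (Fin.rev_lt_rev.mpr hab))
  have := strictMono_val_le_apply ht' (Fin.rev k)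
  simp only [Fin.val_rev, Fin.rev_rev] at this
  have hk := k.2
  have htk := (t k).2
  omega

end Adapted

/-! ### §2.3 Lemma 2.12: `{W_ω(α)}` is a weak `(r, r(n-r))`-lossless rank condenser (PROVED) -/

section Lemma212

variable {F : Type u} [Field F]

/-- **Andrews–Forbes 2022, Lemma 2.12** ([FS12, FG15]; p0014:L7–L17): "Let `F` be a field and let
`ω ∈ F` be an element of multiplicative order at least `n`. Define `W_ω(x) ∈ F[x]^{r × n}` by
`(W_ω(x))_{i,j} = (ω^i x)^j`. Let `S ⊆ F ∖ {0}`. Then `𝓔 = {W_ω(α) : α ∈ S} ⊆ F^{r × n}` is a weak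
`(r, r(n-r))`-lossless rank condenser."  Rendering: "multiplicative order at least `n`" =
`ω ≠ 0 ∧ ω^k ≠ 1` for `0 < k < n` (covers infinite order); `S` a finite set of nonzero scalars;
Def. 2.11's ambient `1 ≤ r ≤ n` is not needed.  PROOF ([FS12]; module docstring): for `A` of rank
`r`, `P(x) = det(W_ω(x) A)` becomes, after an invertible change of basis `G` of the columns
(`P ↦ P · det G`), `x^{Σ(t_k+1)} Q(x)` with `Q(0) = det((ω^{t_k+1})^{i+1}) ≠ 0` for the
order-adapted basis (`t_k` pairwise distinct, `ω` of order `≥ n`), and has degree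
`≤ Σ(t'_k+1) ≤ Σ(t_k+1) + r(n-r)` for the degree-adapted one; so the bad `α ≠ 0` (where
`rank(W_ω(α)A) < r`, i.e. `det = 0`) are among the `≤ r(n-r)` roots of `Q`.
[cite: AndrewsForbes2022, Lemma 2.12] -/
theorem AndrewsForbes2022_lemma_2_12 [DecidableEq F] {r n : ℕ} {ω : F} (hω0 : ω ≠ 0)
    (hω : ∀ k : ℕ, 0 < k → k < n → ω ^ k ≠ 1) (S : Finset F) (hS : (0 : F) ∉ S) :
    IsWeakLosslessRankCondenser F r (r * (n - r)) (S.image (fsCondenser F r n ω)) := by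
  classical
  intro A hA
  obtain ⟨G, t, hG, ht, hpiv, hlow⟩ := exists_mul_orderAdapted A hA
  obtain ⟨G', t', hG', ht', hpiv', hupp⟩ := exists_mul_degreeAdapted A hA
  set P := condPoly r n ω A with hP
  set N := ∑ k, ((t k : ℕ) + 1) with hN
  set N' := ∑ k, ((t' k : ℕ) + 1) with hN'
  -- order structure, transported back along `G`
  obtain ⟨Q₁, hQ₁, hQ₁0⟩ := condPoly_eq_X_pow_mul ω (A * G) t hlow
  have hQ₁ne : Q₁.coeff 0 ≠ 0 := by
    rw [hQ₁0]
    have hmat : (Matrix.of fun i k : Fin r =>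
        ω ^ (((i : ℕ) + 1) * ((t k : ℕ) + 1)) * (A * G) (t k) k) =
        Matrix.of fun i k : Fin r => (ω ^ ((t k : ℕ) + 1)) ^ ((i : ℕ) + 1) := by
      ext i k
      rw [Matrix.of_apply, Matrix.of_apply, hpiv k, mul_one, ← pow_mul, mul_comm]
    rw [hmat]
    refine det_pow_succ_ne_zero _ (fun a b hab => ?_) (fun k => pow_ne_zero _ hω0)
    exact ht.injective (pow_succ_injective_of_order hω0 hω hab)
  have hlowP : ∀ d < N, P.coeff d = 0 := by
    intro d hd
    have h1 : (condPoly r n ω (A * G)).coeff d = 0 := by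
      rw [hQ₁]; exact (Polynomial.X_pow_dvd_iff.mp (dvd_mul_right _ _)) d hd
    rw [condPoly_mul, coeff_mul_C] at h1
    exact (mul_eq_zero.mp h1).resolve_right hG
  have hcoeffP : P.coeff N ≠ 0 := by
    have h1 : (condPoly r n ω (A * G)).coeff N ≠ 0 := by
      rw [hQ₁, coeff_X_pow_mul', if_pos hN.ge, hN, Nat.sub_self]
      exact hQ₁ne
    rw [condPoly_mul, coeff_mul_C] at h1
    exact left_ne_zero_of_mul h1
  -- degree structure, transported back along `G'`
  have hdegP : P.natDegree ≤ N' := by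
    have h1 := natDegree_condPoly_le ω (A * G') t' hupp
    rwa [condPoly_mul, natDegree_mul_C hG'] at h1
  -- combinatorics of two strictly increasing `r`-tuples in `[0, n)`
  have hNN' : N' ≤ r * (n - r) + N := by
    have hrn : r ≤ n := by simpa using Fintype.card_le_of_injective t ht.injective
    have h1 : N' ≤ ∑ k : Fin r, ((n - r) + ((k : ℕ) + 1)) :=
      Finset.sum_le_sum fun k _ => by have := strictMono_apply_add_le ht' k; omega
    have h2 : ∑ k : Fin r, ((k : ℕ) + 1) ≤ N := Finset.sum_le_sum fun k _ => by
      have := strictMono_val_le_apply ht k; omega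
    rw [Finset.sum_add_distrib, Finset.sum_const, Finset.card_univ, Fintype.card_fin,
      smul_eq_mul] at h1
    omega
  -- `P = x^N Q`, `Q ≠ 0`, `deg Q ≤ r(n-r)`
  obtain ⟨Q, hPQ⟩ := Polynomial.X_pow_dvd_iff.mpr hlowP
  have hQ0 : Q ≠ 0 := by
    intro h
    rw [hPQ, h, mul_zero, coeff_zero] at hcoeffP
    exact hcoeffP rfl
  have hQdeg : Q.natDegree ≤ r * (n - r) := by
    have h1 : P.natDegree = N + Q.natDegree := by
      rw [hPQ, natDegree_mul (pow_ne_zero _ X_ne_zero) hQ0, natDegree_X_pow]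
    omega
  -- the bad nonzero `α` are roots of `Q`
  have hsub : S.filter (fun α => (fsCondenser F r n ω α * A).det = 0) ⊆ Q.roots.toFinset := by
    intro α hα
    rw [Finset.mem_filter] at hα
    rw [Multiset.mem_toFinset, mem_roots hQ0, IsRoot.def]
    have hα0 : α ≠ 0 := fun h => hS (h ▸ hα.1)
    have hev : P.eval α = 0 := by rw [hP, condPoly_eval]; exact hα.2
    rw [hPQ, eval_mul, eval_pow, eval_X] at hev
    exact (mul_eq_zero.mp hev).resolve_left (pow_ne_zero _ hα0)
  -- count
  calc ((S.image (fsCondenser F r n ω)).filter fun E => (E * A).rank < r).card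
      ≤ ((S.filter fun α => (fsCondenser F r n ω α * A).det = 0).image (fsCondenser F r n ω)).card := by
        refine Finset.card_le_card fun E hE => ?_
        rw [Finset.mem_filter, Finset.mem_image] at hE
        obtain ⟨⟨α, hαS, rfl⟩, hr⟩ := hE
        refine Finset.mem_image.mpr ⟨α, Finset.mem_filter.mpr ⟨hαS, ?_⟩, rfl⟩
        exact det_eq_zero_of_rank_lt_card (by rwa [Fintype.card_fin])
    _ ≤ (S.filter fun α => (fsCondenser F r n ω α * A).det = 0).card := Finset.card_image_le
    _ ≤ Q.roots.toFinset.card := Finset.card_le_card hsub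
    _ ≤ Multiset.card Q.roots := Multiset.toFinset_card_le _
    _ ≤ Q.natDegree := card_roots' Q
    _ ≤ r * (n - r) := hQdeg

end Lemma212

/-! ### §8 Lemma 8.2 — as printed (false), its true direction, and the two-sided repair -/

section Lemma82

/-- **Andrews–Forbes 2022, Lemma 8.2, AS PRINTED** (p0039:L57–L60): "Let `F` be a field and let
`M ∈ F^{n × n}`. Let `r ≤ n` and let `𝓔 ⊆ F^{r × n}` be a weak `(r, L)`-lossless rank condenser such
that `|𝓔| ≥ 2L + 1`. Then `rank(M) < r` if and only if `det_r(E M Eᵀ) = 0` for all `E ∈ 𝓔`."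
(`det_r` of the `r × r` matrix `E M Eᵀ` is its determinant.)  THIS STATEMENT IS FALSE:
`not_AndrewsForbes2022_lemma_8_2` (erratum; module docstring); kept as the named printed statement.
Its forward direction is `AndrewsForbes2022_lemma_8_2_mp`; the two-sided repair is
`AndrewsForbes2022_lemma_8_2_twoSided`. [cite: AndrewsForbes2022, Lemma 8.2] -/
def AndrewsForbes2022_lemma_8_2 : Prop :=
  ∀ (F : Type) [Field F] (n : ℕ) (M : Matrix (Fin n) (Fin n) F) (r L : ℕ)
    (𝓔 : Finset (Matrix (Fin r) (Fin n) F)), r ≤ n → IsWeakLosslessRankCondenser F r L 𝓔 →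
    2 * L + 1 ≤ 𝓔.card → (M.rank < r ↔ ∀ E ∈ 𝓔, (E * M * Eᵀ).det = 0)

variable {F : Type u} [Field F]

/-- **Lemma 8.2, direction `⇒`** (true as printed, p0039:L63–L64: "if `rank(M) < r`, then
`rank(E M Eᵀ) < r` … it is immediate that `det_r(E M Eᵀ) = 0`"), for arbitrary `E`, `E'` on the
two sides. [cite: AndrewsForbes2022, Lemma 8.2 (proof, first direction)] -/
theorem AndrewsForbes2022_lemma_8_2_mp {n r : ℕ} {M : Matrix (Fin n) (Fin n) F} (hM : M.rank < r)
    (E E' : Matrix (Fin r) (Fin n) F) : (E * M * E'ᵀ).det = 0 := by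
  apply det_eq_zero_of_rank_lt_card
  calc (E * M * E'ᵀ).rank ≤ (E * M).rank := rank_mul_le_left _ _
    _ ≤ M.rank := rank_mul_le_right _ _
    _ < r := hM
    _ = Fintype.card (Fin r) := (Fintype.card_fin r).symm

/-- **ERRATUM: Lemma 8.2 as printed is false.**  Counterexample over `ℚ` with `n = 2`, `r = 1`,
`L = 1`: `𝓔 = {(1 1), (1 2), (1 3)} ⊆ ℚ^{1 × 2}` is a weak `(1, 1)`-lossless rank condenser with
`|𝓔| = 3 = 2L + 1` (a nonzero column `(a, b)ᵀ` is killed by `(1 k)` iff `a + k b = 0`, by at most one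
`k`), the alternating matrix `M = (0 1; -1 0)` has rank `2 ≥ r`, yet `E M Eᵀ = 0` for every row
vector `E`.  (The printed proof, p0039:L94–L97, infers `rank(E A Bᵀ Eᵀ) = r` from `rank(EA) = r`
and `rank(EB) = r`, which fails for `rank(M) > r`.) [cite: AndrewsForbes2022, Lemma 8.2] -/
theorem not_AndrewsForbes2022_lemma_8_2 : ¬ AndrewsForbes2022_lemma_8_2 := by
  intro h
  let M : Matrix (Fin 2) (Fin 2) ℚ := !![0, 1; -1, 0]
  let E : ℚ → Matrix (Fin 1) (Fin 2) ℚ := fun k => !![1, k]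
  let 𝓔 : Finset (Matrix (Fin 1) (Fin 2) ℚ) := {E 1, E 2, E 3}
  have hE : Function.Injective E := fun a b hab => by
    simpa [E] using congr_fun (congr_fun hab 0) 1
  have hcard : 𝓔.card = 3 :=
    Finset.card_eq_three.mpr ⟨E 1, E 2, E 3, hE.ne (by norm_num), hE.ne (by norm_num),
      hE.ne (by norm_num), rfl⟩
  -- the `1 × 1` matrix `(1 k) A` is the scalar `a + k b`
  have hentry : ∀ (k : ℚ) (A : Matrix (Fin 2) (Fin 1) ℚ), (E k * A) 0 0 = A 0 0 + k * A 1 0 := by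
    intro k A
    simp [E, Matrix.mul_apply, Fin.sum_univ_two]
  have hkill : ∀ (k : ℚ) (A : Matrix (Fin 2) (Fin 1) ℚ), (E k * A).rank < 1 →
      A 0 0 + k * A 1 0 = 0 := by
    intro k A hk
    by_contra hne
    have hdet : (E k * A).det ≠ 0 := by
      rw [Matrix.det_unique, Fin.default_eq_zero, hentry]
      exact hne
    have := rank_eq_card_of_det_ne_zero hdet
    rw [Fintype.card_fin] at this
    omega
  have hloss : IsWeakLosslessRankCondenser ℚ 1 1 𝓔 := by
    intro A hA
    classical
    have hA0 : ∀ k k' : ℚ, k ≠ k' → (E k * A).rank < 1 → (E k' * A).rank < 1 → False := by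
      intro k k' hkk hk hk'
      have h1 := hkill k A hk
      have h2 := hkill k' A hk'
      have h10 : A 1 0 = 0 := by
        have h3 : (k - k') * A 1 0 = 0 := by linear_combination h1 - h2
        exact (mul_eq_zero.mp h3).resolve_left (sub_ne_zero.mpr hkk)
      have h00 : A 0 0 = 0 := by rw [h10, mul_zero, add_zero] at h1; exact h1
      have hAz : A = 0 := by
        ext i j
        fin_cases i <;> fin_cases j
        · exact h00
        · exact h10
      rw [hAz, Matrix.rank_zero] at hA
      exact zero_ne_one hA
    refine Finset.card_le_one.mpr ?_
    intro X hX Y hY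
    rw [Finset.mem_filter] at hX hY
    obtain ⟨hX1, hX2⟩ := hX
    obtain ⟨hY1, hY2⟩ := hY
    simp only [𝓔, Finset.mem_insert, Finset.mem_singleton] at hX1 hY1
    rcases hX1 with rfl | rfl | rfl <;> rcases hY1 with rfl | rfl | rfl <;>
      first
      | rfl
      | exact (hA0 _ _ (by norm_num) hX2 hY2).elim
  have hiff := h ℚ 2 M 1 1 𝓔 (by norm_num) hloss (by rw [hcard])
  have hrhs : ∀ E' ∈ 𝓔, (E' * M * E'ᵀ).det = 0 := by
    intro E' _
    rw [Matrix.det_unique, Fin.default_eq_zero]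
    simp [M, Matrix.mul_apply, Fin.sum_univ_two]
    ring
  have hM : M.rank = 2 := by
    have := rank_eq_card_of_det_ne_zero (A := M) (by simp [M, Matrix.det_fin_two])
    rwa [Fintype.card_fin] at this
  have hlt := hiff.mpr hrhs
  omega

/-- **Lemma 8.2, REPAIRED (two-sided condensing)**: let `𝓔 ⊆ F^{r × n}` be a weak `(r, L)`-lossless
rank condenser with `|𝓔| ≥ L + 1` and `M ∈ F^{n × n}`. Then `rank(M) < r` iff
`det_r(E M E'ᵀ) = 0` for all `E, E' ∈ 𝓔`.  Proof (ours, the natural repair of p0039:L66–L100):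
if `rank(M) ≥ r`, pick `G` with `rank(MG) = r` (`r` independent vectors of the column space); all
but `≤ L` matrices `E ∈ 𝓔` have `rank(EMG) = r`, hence `rank(EM) = r`; for such an `E`, `(EM)ᵀ` has
rank `r`, so all but `≤ L` matrices `E' ∈ 𝓔` have `rank(E'(EM)ᵀ) = r`, i.e. `det_r(E M E'ᵀ) ≠ 0`.
[cite: AndrewsForbes2022, Lemma 8.2] -/
theorem AndrewsForbes2022_lemma_8_2_twoSided {n r L : ℕ} (M : Matrix (Fin n) (Fin n) F)
    {𝓔 : Finset (Matrix (Fin r) (Fin n) F)} (h𝓔 : IsWeakLosslessRankCondenser F r L 𝓔)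
    (hcard : L + 1 ≤ 𝓔.card) :
    M.rank < r ↔ ∀ E ∈ 𝓔, ∀ E' ∈ 𝓔, (E * M * E'ᵀ).det = 0 := by
  classical
  refine ⟨fun hM E _ E' _ => AndrewsForbes2022_lemma_8_2_mp hM E E', fun hall => ?_⟩
  by_contra hM
  push Not at hM
  -- for an `n × r` matrix `N` of rank `r`, some `E ∈ 𝓔` keeps the rank
  have good : ∀ N : Matrix (Fin n) (Fin r) F, N.rank = r → ∃ E ∈ 𝓔, (E * N).rank = r := by
    intro N hN
    by_contra hno
    push Not at hno
    have hall' : ∀ E ∈ 𝓔, (E * N).rank < r := fun E hE =>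
      lt_of_le_of_ne ((rank_le_card_height _).trans (Fintype.card_fin r).le) (hno E hE)
    have hfil : 𝓔.filter (fun E => (E * N).rank < r) = 𝓔 := Finset.filter_true_of_mem hall'
    have := h𝓔 N hN
    rw [hfil] at this
    omega
  obtain ⟨G, hG⟩ := exists_rank_mul_eq M hM
  obtain ⟨E, hE, hEr⟩ := good (M * G) hG
  have hEM : (E * M).rank = r := by
    refine le_antisymm ((rank_le_card_height _).trans (Fintype.card_fin r).le) ?_
    calc r = (E * (M * G)).rank := hEr.symm
      _ = (E * M * G).rank := by rw [Matrix.mul_assoc]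
      _ ≤ (E * M).rank := rank_mul_le_left _ _
  have hN : ((E * M)ᵀ).rank = r := by rw [rank_transpose]; exact hEM
  obtain ⟨E', hE', hE'r⟩ := good (E * M)ᵀ hN
  have hdet : (E' * (E * M)ᵀ).det ≠ 0 :=
    det_ne_zero_of_rank_eq_card (by rw [hE'r, Fintype.card_fin])
  apply hdet
  rw [← det_transpose, transpose_mul, transpose_transpose]
  exact hall E hE E' hE'

end Lemma82

end Literature.Computability.AlgebraicComplexity
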